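import Mathlib.Topology.Algebra.OpenSubgroup
import Mathlib.Topology.LocallyConstant.Basic
import HarnessLib

/-!
# Tate's theorem `H²(G_ℚ, ℚ/ℤ) = 0` at level one, VIII: `2`-cocycles split on a subgroup of
# index two (the Gysin / restriction–corestriction sequence in degree `2`, explicit form)

Sibling proof file (theorems only) of `TateProjectiveLifting.lean`; pure group theory, used for
`p = 2` with `G = Γ_ℚ ⊃ H = Γ_{ℚ(i)}` and `c` a complex conjugation.

Let `H ≤ G` be a subgroup of index `2`, `c ∈ G` with `c² = 1`, `G = H ⊔ Hc`, `cHc = H`, and let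
`A` be an elementary abelian `2`-group.  For the exact sequence
`H¹(G, A) —(∪ χ_H)→ H²(G, A) —res→ H²(H, A)` (`χ_H : G → ℤ/2` the character with kernel `H`;
Gysin sequence of `0 → A → Ind_H^G A → A → 0`) we prove the cochain-level statement actually
needed: **a `2`-cocycle `z : G × G → A` (trivial action) whose restriction to `H` is a coboundary
is `z(x, y) = χ_H(x) w(y) + ∂δ(x, y)` for an additive character `w : G → A` and a cochain `δ`,**
both given by explicit formulas in `z`, the splitting cochain and `c` (hence locally constant when
the data are, `H` being open):

* `twoCocycle_indexTwo_eq_cup_add_coboundary` — the algebraic identity;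
* `twoCocycle_indexTwo_eq_cup_add_coboundary_lc` — the same with local constancy.

Proof (Serre, *Galois Cohomology* I §2.6 Exercise 2 / Arason, *J. Algebra* 36 (1975) 448–491,
Satz 4.5, made explicit): first correct `z` by `∂β̃` (`β̃` the splitting cochain extended along
`x ↦ xc`) so that `z|_{H×H} = 0`; then by `∂γ₁`, `γ₁(hc) = z(h, c)`, so that `z|_{H×G} = 0`
(cocycle identity); a cocycle vanishing on `H × G` satisfies `z(hx, y) = z(x, y)`, whence
`z(x, y) = χ_H(x) z(c, y)`, and `w = z(c, ·)` is additive by the cocycle identities at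
`(c, c, y)` and `(c, h, y)`.

## References

* J.-P. Serre, *Modular forms of weight one and Galois representations* (Durham 1977), §6.5.
  [SerreDurham1977]
* J.-P. Serre, *Galois Cohomology* (1997), I §2.6. [SerreGaloisCohomology1997]
-/

namespace Literature.NumberTheory.GaloisRepresentations

section IndexTwo

variable {G : Type*} [Group G] {A : Type*} [AddCommGroup A]

/-- In an elementary abelian `2`-group, `-a = a`. [folklore] -/
theorem neg_eq_self_of_add_self (hA : ∀ a : A, a + a = 0) (a : A) : -a = a :=
  neg_eq_of_add_eq_zero_left (hA a)

/-- In an elementary abelian `2`-group, `a - b = a + b`. [folklore] -/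
theorem sub_eq_add_of_add_self (hA : ∀ a : A, a + a = 0) (a b : A) : a - b = a + b := by
  rw [sub_eq_add_neg, neg_eq_self_of_add_self hA]

/-- In an elementary abelian `2`-group, `(x, y) ↦ f x + f y + f (xy)` satisfies the `2`-cocycle
identity. [folklore] -/
theorem coboundary₂_cocycle (hA : ∀ a : A, a + a = 0) (f : G → A) (σ τ υ : G) :
    (f σ + f τ + f (σ * τ)) + (f (σ * τ) + f υ + f (σ * τ * υ)) =
      (f τ + f υ + f (τ * υ)) + (f σ + f (τ * υ) + f (σ * (τ * υ))) := by
  have e1 : (f σ + f τ + f (σ * τ)) + (f (σ * τ) + f υ + f (σ * τ * υ)) =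
      (f σ + f τ + f υ + f (σ * τ * υ)) + (f (σ * τ) + f (σ * τ)) := by abel
  have e2 : (f τ + f υ + f (τ * υ)) + (f σ + f (τ * υ) + f (σ * (τ * υ))) =
      (f σ + f τ + f υ + f (σ * (τ * υ))) + (f (τ * υ) + f (τ * υ)) := by abel
  rw [e1, e2, hA, hA, mul_assoc]

/-- A locally constant function defined by cases along a clopen set is locally constant. [folklore] -/
theorem isLocallyConstant_ite_mem {X Y : Type*} [TopologicalSpace X] {s : Set X}
    [DecidablePred (· ∈ s)] (hs : IsClopen s) {f g : X → Y} (hf : IsLocallyConstant f)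
    (hg : IsLocallyConstant g) : IsLocallyConstant fun x => if x ∈ s then f x else g x := by
  rw [IsLocallyConstant.iff_exists_open]
  intro x
  obtain ⟨U, hU, hxU, hUf⟩ := hf.exists_open x
  obtain ⟨V, hV, hxV, hVg⟩ := hg.exists_open x
  by_cases hx : x ∈ s
  · refine ⟨U ∩ s, hU.inter hs.isOpen, ⟨hxU, hx⟩, fun y hy => ?_⟩
    rw [if_pos hy.2, if_pos hx]
    exact hUf y hy.1
  · refine ⟨V ∩ sᶜ, hV.inter hs.compl.isOpen, ⟨hxV, hx⟩, fun y hy => ?_⟩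
    rw [if_neg (show y ∉ s from hy.2), if_neg hx]
    exact hVg y hy.1

/-- **`2`-cocycles split on a subgroup of index two** (explicit Gysin sequence in degree `2`).
Let `H ≤ G` be an open subgroup and `c ∈ G ∖ H` with `c² = 1`, `G = H ∪ Hc` and `cHc ⊆ H`; let `A`
be an elementary abelian `2`-group, `z : G × G → A` a locally constant `2`-cocycle (trivial
action) and `β` a locally constant cochain splitting `z` on `H`.  Then there are a locally constant
additive character `w : G → A` and a locally constant cochain `δ` with
`z(x, y) = χ_H(x) w(y) + δ(x) + δ(y) + δ(xy)`, `χ_H(x) w(y) = 0` for `x ∈ H` and `= w(y)` otherwise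
(`z = χ_H ∪ w + ∂δ`).
[cite: SerreGaloisCohomology1997, I §2.6] [cite: SerreDurham1977, §6.5] -/
theorem twoCocycle_indexTwo_eq_cup_add_coboundary [TopologicalSpace G] [ContinuousMul G]
    (hA : ∀ a : A, a + a = 0) (H : Subgroup G) [DecidablePred (· ∈ H)] (hHopen : IsOpen (H : Set G))
    (c : G) (hcc : c * c = 1) (hHc : ∀ x, x ∉ H → x * c ∈ H) (hnorm : ∀ h ∈ H, c * h * c ∈ H)
    (z : G → G → A) (hz_lc : IsLocallyConstant (Function.uncurry z))
    (hcoc : ∀ σ τ υ, z σ τ + z (σ * τ) υ = z τ υ + z σ (τ * υ))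
    (β : G → A) (hβ_lc : IsLocallyConstant β)
    (hβ : ∀ h ∈ H, ∀ k ∈ H, z h k + β (h * k) = β h + β k) :
    ∃ (w δ : G → A), IsLocallyConstant w ∧ IsLocallyConstant δ ∧ (∀ x y, w (x * y) = w x + w y) ∧
      ∀ x y, z x y = (if x ∈ H then 0 else w y) + (δ x + δ y + δ (x * y)) := by
  have hneg : ∀ a : A, -a = a := neg_eq_self_of_add_self hA
  have hHclopen : IsClopen (H : Set G) := ⟨H.isClosed_of_isOpen hHopen, hHopen⟩
  have hxcc : ∀ x : G, x * c * c = x := fun x => by rw [mul_assoc, hcc, mul_one]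
  -- Step 0: `z₁ = z + ∂β̃` vanishes on `H × H`
  set βt : G → A := fun x => if x ∈ H then β x else β (x * c) with hβt
  have hβt_lc : IsLocallyConstant βt :=
    isLocallyConstant_ite_mem hHclopen hβ_lc (hβ_lc.comp_continuous (continuous_mul_const c))
  set z₁ : G → G → A := fun x y => z x y + (βt x + βt y + βt (x * y)) with hz₁
  have hz₁_lc : IsLocallyConstant (Function.uncurry z₁) := by
    have h1 : IsLocallyConstant fun q : G × G => βt q.1 := hβt_lc.comp_continuous continuous_fst
    have h2 : IsLocallyConstant fun q : G × G => βt q.2 := hβt_lc.comp_continuous continuous_snd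
    have h3 : IsLocallyConstant fun q : G × G => βt (q.1 * q.2) :=
      hβt_lc.comp_continuous continuous_mul
    exact hz_lc.comp₂ ((h1.comp₂ h2 fun a b => a + b).comp₂ h3 fun a b => a + b) fun a b => a + b
  have hz₁_coc : ∀ σ τ υ, z₁ σ τ + z₁ (σ * τ) υ = z₁ τ υ + z₁ σ (τ * υ) := fun σ τ υ => by
    have e := coboundary₂_cocycle hA βt σ τ υ
    simp only [hz₁]
    calc z σ τ + (βt σ + βt τ + βt (σ * τ)) + (z (σ * τ) υ + (βt (σ * τ) + βt υ + βt (σ * τ * υ)))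
        = (z σ τ + z (σ * τ) υ) +
            ((βt σ + βt τ + βt (σ * τ)) + (βt (σ * τ) + βt υ + βt (σ * τ * υ))) := by abel
      _ = (z τ υ + z σ (τ * υ)) +
            ((βt τ + βt υ + βt (τ * υ)) + (βt σ + βt (τ * υ) + βt (σ * (τ * υ)))) := by
          rw [hcoc, e]
      _ = _ := by abel
  have hz₁H : ∀ h ∈ H, ∀ k ∈ H, z₁ h k = 0 := fun h hh k hk => by
    simp only [hz₁, hβt]
    rw [if_pos hh, if_pos hk, if_pos (H.mul_mem hh hk)]
    calc z h k + (β h + β k + β (h * k)) = (z h k + β (h * k)) + (β h + β k) := by abel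
      _ = 0 := by rw [hβ h hh k hk, hA]
  -- Step 1: `z₂ = z₁ + ∂γ₁` vanishes on `H × G`
  set γ₁ : G → A := fun x => if x ∈ H then 0 else z₁ (x * c) c with hγ₁
  have hγ₁_lc : IsLocallyConstant γ₁ :=
    isLocallyConstant_ite_mem hHclopen (IsLocallyConstant.const 0)
      (hz₁_lc.comp_continuous ((continuous_mul_const c).prodMk continuous_const))
  set z₂ : G → G → A := fun x y => z₁ x y + (γ₁ x + γ₁ y + γ₁ (x * y)) with hz₂
  have hz₂_coc : ∀ σ τ υ, z₂ σ τ + z₂ (σ * τ) υ = z₂ τ υ + z₂ σ (τ * υ) := fun σ τ υ => by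
    have e := coboundary₂_cocycle hA γ₁ σ τ υ
    simp only [hz₂]
    calc z₁ σ τ + (γ₁ σ + γ₁ τ + γ₁ (σ * τ)) + (z₁ (σ * τ) υ + (γ₁ (σ * τ) + γ₁ υ + γ₁ (σ * τ * υ)))
        = (z₁ σ τ + z₁ (σ * τ) υ) +
            ((γ₁ σ + γ₁ τ + γ₁ (σ * τ)) + (γ₁ (σ * τ) + γ₁ υ + γ₁ (σ * τ * υ))) := by abel
      _ = (z₁ τ υ + z₁ σ (τ * υ)) +
            ((γ₁ τ + γ₁ υ + γ₁ (τ * υ)) + (γ₁ σ + γ₁ (τ * υ) + γ₁ (σ * (τ * υ)))) := by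
          rw [hz₁_coc, e]
      _ = _ := by abel
  have hz₂H : ∀ h ∈ H, ∀ y, z₂ h y = 0 := fun h hh y => by
    simp only [hz₂, hγ₁]
    rw [if_pos hh, zero_add]
    by_cases hy : y ∈ H
    · rw [if_pos hy, if_pos (H.mul_mem hh hy), hz₁H h hh y hy, zero_add, zero_add]
    · have hk : y * c ∈ H := hHc y hy
      have hhy : h * y ∉ H := fun h' => hy (by simpa using H.mul_mem (H.inv_mem hh) h')
      rw [if_neg hy, if_neg hhy]
      -- cocycle identity for `z₁` at `(h, yc, c)`
      have e := hz₁_coc h (y * c) c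
      rw [hz₁H h hh _ hk, zero_add, hxcc, ← mul_assoc] at e
      -- `e : z₁ (h * y) c = z₁ (y * c) c + z₁ h y`
      rw [e]
      calc z₁ h y + (z₁ (y * c) c + (z₁ (y * c) c + z₁ h y))
          = (z₁ h y + z₁ h y) + (z₁ (y * c) c + z₁ (y * c) c) := by abel
        _ = 0 := by rw [hA, hA, add_zero]
  -- Step 2: structure of a cocycle vanishing on `H × G`
  have hP1 : ∀ h ∈ H, ∀ x y, z₂ (h * x) y = z₂ x y := fun h hh x y => by
    have e := hz₂_coc h x y
    rwa [hz₂H h hh, hz₂H h hh, zero_add, add_zero] at e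
  set w : G → A := fun y => z₂ c y with hw
  have hdec : ∀ x y, z₂ x y = if x ∈ H then 0 else w y := fun x y => by
    by_cases hx : x ∈ H
    · rw [if_pos hx, hz₂H x hx]
    · rw [if_neg hx, hw]
      conv_lhs => rw [← hxcc x]
      exact hP1 _ (hHc x hx) c y
  have hwc : ∀ y, w (c * y) = w c + w y := fun y => by
    have e := hz₂_coc c c y
    rw [hcc, hz₂H 1 H.one_mem, add_zero] at e
    -- `e : z₂ c c = z₂ c y + z₂ c (c * y)`
    show z₂ c (c * y) = z₂ c c + z₂ c y
    rw [e]
    calc z₂ c (c * y) = z₂ c (c * y) + (z₂ c y + z₂ c y) := by rw [hA, add_zero]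
      _ = z₂ c y + z₂ c (c * y) + z₂ c y := by abel
  have hwh : ∀ h ∈ H, ∀ y, w (h * y) = w h + w y := fun h hh y => by
    have e := hz₂_coc c h y
    rw [hz₂H h hh, zero_add] at e
    -- `e : z₂ c h + z₂ (c * h) y = z₂ c (h * y)`
    have e2 : z₂ (c * h) y = z₂ c y := by
      conv_lhs => rw [← hxcc (c * h)]
      exact hP1 _ (hnorm h hh) c y
    show z₂ c (h * y) = z₂ c h + z₂ c y
    rw [← e, e2]
  have hw_add : ∀ x y, w (x * y) = w x + w y := fun x y => by
    by_cases hx : x ∈ H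
    · exact hwh x hx y
    · have hk : x * c ∈ H := hHc x hx
      have ex : x = x * c * c := (hxcc x).symm
      calc w (x * y) = w (x * c * (c * y)) := by rw [← mul_assoc, hxcc]
        _ = w (x * c) + (w c + w y) := by rw [hwh _ hk, hwc]
        _ = (w (x * c) + w c) + w y := by abel
        _ = w (x * c * c) + w y := by rw [hwh _ hk]
        _ = w x + w y := by rw [hxcc]
  -- Step 3: assemble
  have hz₂_lc : IsLocallyConstant (Function.uncurry z₂) := by
    have h1 : IsLocallyConstant fun q : G × G => γ₁ q.1 := hγ₁_lc.comp_continuous continuous_fst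
    have h2 : IsLocallyConstant fun q : G × G => γ₁ q.2 := hγ₁_lc.comp_continuous continuous_snd
    have h3 : IsLocallyConstant fun q : G × G => γ₁ (q.1 * q.2) :=
      hγ₁_lc.comp_continuous continuous_mul
    exact hz₁_lc.comp₂ ((h1.comp₂ h2 fun a b => a + b).comp₂ h3 fun a b => a + b) fun a b => a + b
  have hw_lc : IsLocallyConstant w := hz₂_lc.comp_continuous (continuous_const.prodMk continuous_id)
  refine ⟨w, fun x => βt x + γ₁ x, hw_lc, hβt_lc.comp₂ hγ₁_lc fun a b => a + b, hw_add,
    fun x y => ?_⟩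
  rw [← hdec x y]
  simp only [hz₂, hz₁]
  calc z x y = z x y + ((βt x + βt y + βt (x * y)) + (βt x + βt y + βt (x * y))) +
        ((γ₁ x + γ₁ y + γ₁ (x * y)) + (γ₁ x + γ₁ y + γ₁ (x * y))) := by
          rw [hA, hA, add_zero, add_zero]
    _ = _ := by abel

end IndexTwo

end Literature.NumberTheory.GaloisRepresentations
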